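import Summits.RiemannHypothesis.RiemannHypothesis.Theorems.ThetaTier1Cheb
import Summits.RiemannHypothesis.RiemannHypothesis.Theorems.ThetaTier1Closed
import HarnessLib

/-!
# THETA tier-1 — the REGISTERS of the Chebyshev-variant program in closed form (reading aid; cc-s2-1, WEIL typing lane;
RH-FREE bookkeeping)

The analogue of `ThetaTier1Closed.lean` for `Row.insCheb` / `Row.envCheb` (`ThetaTier1Cheb.lean`): `Row.envCheb_eq_eval`,
`Row.envCheb_atom`, and the register equations `Row.envCheb_21 … envCheb_41` (identical to `Row.env_*` except
`envCheb_31` = the Chebyshev cross term and the extra `envCheb_41 = log N`).  Nothing here bears on the truth of RH.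
-/

set_option linter.dupNamespace false  -- the mandated namespace repeats `RiemannHypothesis`
set_option autoImplicit false

namespace Summit.RiemannHypothesis.RiemannHypothesis.Theorems.ThetaTier1

open Literature.Analysis.ValidatedNumerics

/-- **A register of the variant program equals its instruction evaluated on the FINAL registers**, provided the instruction
reads only lower registers. [this cell] -/
theorem Row.envCheb_eq_eval (r : Row) (j : ℕ) (hj : j < r.insCheb.length)
    (hv : varsBelow (21 + j) (r.insCheb[j]'hj) = true) : r.envCheb (21 + j) = (r.insCheb[j]'hj).eval r.envCheb := by
  rw [Row.envCheb, runR_getElem r.insCheb r.vals 21 j hj]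
  exact eval_congr_below (fun i hi => runR_take_agree r.insCheb r.vals 21 j i hi) _ hv

/-- The variant program has twenty-one instructions. [this cell] -/
theorem Row.length_insCheb (r : Row) : r.insCheb.length = 21 := rfl

/-- Registers `0 … 20` of the variant are the atoms. [this cell] -/
theorem Row.envCheb_atom (r : Row) {i : ℕ} (hi : i < 21) : r.envCheb i = r.vals i := runR_of_lt _ _ _ _ hi

/-! ## The register equations of the Chebyshev-variant program -/

section Registers
variable (r : Row)

/-- One register step: instruction `j`, named `e`, reading only lower registers. [this cell] -/
private theorem envCheb_step (j : ℕ) (hj : j < 21) (e : RExpr) (he : r.insCheb[j]'(by rw [Row.length_insCheb]; exact hj) = e)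
    (hv : varsBelow (21 + j) e = true) : r.envCheb (21 + j) = e.eval r.envCheb := by
  have := r.envCheb_eq_eval j (by rw [Row.length_insCheb]; exact hj) (he ▸ hv)
  simpa [he] using this

/-- 21: `u₁ = e^{η′-δ}/√q`. [this cell, THETA-CERT-cc6 §D] -/
theorem Row.envCheb_21 : r.envCheb 21 = r.vals 15 * (r.vals 20)⁻¹ := by
  rw [envCheb_step r 0 (by norm_num) r.iU1 rfl rfl]
  simp [Row.iU1, rdiv, RExpr.eval, r.envCheb_atom]

/-- 22: `ζ* = 4πδq · e^{2δ-η′}` (`(4δq) · (π · e^{2δ-η′})`). [this cell, THETA-CERT-cc6 D1] -/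
theorem Row.envCheb_22 : r.envCheb 22 = ((4 * r.delta * r.q : ℚ) : ℝ) * (r.vals 10 * r.vals 14) := by
  rw [envCheb_step r 1 (by norm_num) r.iZeta rfl rfl]
  simp [Row.iZeta, RExpr.eval, r.envCheb_atom]

/-- 23: `m/ζ*`. [this cell, THETA-CERT-cc6 D1] -/
theorem Row.envCheb_23 : r.envCheb 23 = ((r.m : ℚ) : ℝ) * (r.envCheb 22)⁻¹ := by
  rw [envCheb_step r 2 (by norm_num) r.iMZ rfl rfl]
  simp [Row.iMZ, rdiv, RExpr.eval]

/-- 24: `(m/ζ*)^m`. [this cell, THETA-CERT-cc6 D1] -/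
theorem Row.envCheb_24 : r.envCheb 24 = r.envCheb 23 ^ r.m := by
  rw [envCheb_step r 3 (by norm_num) r.iMZM rfl (varsBelow_rpow rfl _)]
  simp [Row.iMZM, eval_rpow, RExpr.eval]

/-- 25: `M = (Σ|cᵢ|/π)·ζ⁺(m+1)·(m/ζ*)^m`. [this cell, THETA-CERT-cc6 D1] -/
theorem Row.envCheb_25 : r.envCheb 25 = ((r.csum : ℚ) : ℝ) * (r.vals 10)⁻¹ * ((zetaHi (r.m + 1) : ℚ) : ℝ) * r.envCheb 24 := by
  rw [envCheb_step r 4 (by norm_num) r.iM rfl rfl]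
  simp [Row.iM, rdiv, RExpr.eval, r.envCheb_atom]

/-- 26: `M₁ = 2qΣ|cᵢ|ζ⁺(m) · e^{2δ-η′} · (1 + ε(1 + m/ζ*)) · (m/ζ*)^m`. [this cell, THETA-CERT-cc6 D2] -/
theorem Row.envCheb_26 : r.envCheb 26 = ((2 * r.q * r.csum * zetaHi r.m : ℚ) : ℝ) * r.vals 14 *
    (1 + ((r.eps : ℚ) : ℝ) * (1 + r.envCheb 23)) * r.envCheb 24 := by
  rw [envCheb_step r 5 (by norm_num) r.iM1 rfl rfl]
  simp [Row.iM1, RExpr.eval, r.envCheb_atom]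

/-- 27: `A = 2/(2m+1) · M² · u₁`. [this cell, THETA-CERT-cc6 D3] -/
theorem Row.envCheb_27 : r.envCheb 27 = ((2 / (2 * r.m + 1) : ℚ) : ℝ) * r.envCheb 25 ^ 2 * r.envCheb 21 := by
  rw [envCheb_step r 6 (by norm_num) r.iA rfl rfl]
  simp [Row.iA, RExpr.eval]

/-- 28: `‖T′‖₂⁺ = (1/2 + m/η′)·M·√(u₁/(2m+1)) + M₁·√(u₁/(2m-1))`. [this cell, THETA-CERT-cc6 D3] -/
theorem Row.envCheb_28 : r.envCheb 28 = ((1 / 2 + r.m / ETA : ℚ) : ℝ) * r.envCheb 25 * Real.sqrt (r.envCheb 21 * ((1 / (2 * r.m + 1) : ℚ) : ℝ)) +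
    r.envCheb 26 * Real.sqrt (r.envCheb 21 * ((1 / (2 * r.m - 1) : ℚ) : ℝ)) := by
  rw [envCheb_step r 7 (by norm_num) r.iBin rfl rfl]
  simp [Row.iBin, RExpr.eval]

/-- 29: `B = 2·(‖T′‖₂⁺)²`. [this cell, THETA-CERT-cc6 D3] -/
theorem Row.envCheb_29 : r.envCheb 29 = 2 * r.envCheb 28 ^ 2 := by
  rw [envCheb_step r 8 (by norm_num) r.iB rfl rfl]
  simp [Row.iB, RExpr.eval]

/-- 30: `primesC = 4Λ⁺(m+1)/(2m+1) · M² · u₁`. [this cell, THETA-CERT-cc6 D6] -/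
theorem Row.envCheb_30 : r.envCheb 30 = ((4 * pLamHi (r.m + 1) / (2 * r.m + 1) : ℚ) : ℝ) * r.envCheb 25 ^ 2 * r.envCheb 21 := by
  rw [envCheb_step r 9 (by norm_num) r.iPrimesC rfl rfl]
  simp [Row.iPrimesC, RExpr.eval]

/-- 31′: `cross = 2·C(N)·M²·(1/m² + e^{-m/(m+1)}/(m+1))`, `C(N) = 2 log 2 + 2(log q + 2δ − 2η′)·u₁`. [this cell, THETA-CERT-cc6 D6 / ATTEMPT-22 §5] -/
theorem Row.envCheb_31 : r.envCheb 31 = 2 * (2 * r.vals 9 + 2 * (r.vals 19 + ((2 * r.delta - 2 * ETA : ℚ) : ℝ)) * r.envCheb 21) *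
    (r.envCheb 25 ^ 2 * (((1 / (r.m : ℚ) ^ 2 : ℚ) : ℝ) + r.vals 16 * ((1 / ((r.m : ℚ) + 1) : ℚ) : ℝ))) := by
  rw [envCheb_step r 10 (by norm_num) r.iCrossCheb rfl rfl]
  simp [Row.iCrossCheb, Row.iCcheb, RExpr.eval, r.envCheb_atom]

/-- 32: `J(t₀)⁺ = k log 2 + 1/2 + e^{1/2}/16 + Σ_{j≤5} e^{-(4j+1)/2}·4/(4j+1) + e^{-25/2}·(4/25)/(1 - e^{-2})`. [this cell, THETA-CERT-cc6 D7] -/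
theorem Row.envCheb_32 : r.envCheb 32 = ((r.k : ℚ) : ℝ) * r.vals 9 + ((1 / 2 : ℚ) : ℝ) + r.vals 0 * ((1 / 16 : ℚ) : ℝ) +
    (r.vals 1 * 4 + r.vals 2 * ((4 / 5 : ℚ) : ℝ) + r.vals 3 * ((4 / 9 : ℚ) : ℝ) + r.vals 4 * ((4 / 13 : ℚ) : ℝ) +
      r.vals 5 * ((4 / 17 : ℚ) : ℝ) + r.vals 6 * ((4 / 21 : ℚ) : ℝ) + r.vals 7 * ((4 / 25 : ℚ) : ℝ) * (1 - r.vals 8)⁻¹) := by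
  rw [envCheb_step r 11 (by norm_num) r.iJ rfl rfl]
  simp [Row.iJ, RExpr.eval, r.envCheb_atom]

/-- 33: `archc = 2J − log 4π − γ⁻ − (π/2 + log 2)`. [this cell, THETA-CERT-cc6 D7] -/
theorem Row.envCheb_33 : r.envCheb 33 = 2 * r.envCheb 32 - r.vals 11 - ((GAMMA_LO : ℚ) : ℝ) - (r.vals 10 * ((1 / 2 : ℚ) : ℝ) + r.vals 9) := by
  rw [envCheb_step r 12 (by norm_num) r.iArchc rfl rfl]
  simp [Row.iArchc, RExpr.eval, r.envCheb_atom]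

/-- 34: `arch = B · e^{t₀/2} · t₀²/4 + A · max(0, archc)`. [this cell, THETA-CERT-cc6 D7] -/
theorem Row.envCheb_34 : r.envCheb 34 = r.envCheb 29 * r.vals 17 * ((r.t0 ^ 2 / 4 : ℚ) : ℝ) + r.envCheb 27 * max 0 (r.envCheb 33) := by
  rw [envCheb_step r 13 (by norm_num) r.iArch rfl rfl]
  simp [Row.iArch, RExpr.eval, r.envCheb_atom]

/-- 35: `M_L = M · e^{m(2δ-η′)}`. [this cell, THETA-CERT-cc6 D4] -/
theorem Row.envCheb_35 : r.envCheb 35 = r.envCheb 25 * r.vals 18 := by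
  rw [envCheb_step r 14 (by norm_num) r.iML rfl rfl]
  simp [Row.iML, RExpr.eval, r.envCheb_atom]

/-- 36: `r̄ = 4δ h_max χ_L · e^δ · M_L + 2δχ_L² · e^δ · M_L²/√q`. [this cell, THETA-CERT-cc6 D4] -/
theorem Row.envCheb_36 : r.envCheb 36 = ((4 * r.delta * r.hmax * r.chiL : ℚ) : ℝ) * r.vals 13 * r.envCheb 35 +
    ((2 * r.delta * r.chiL ^ 2 : ℚ) : ℝ) * r.vals 13 * (r.vals 20)⁻¹ * r.envCheb 35 ^ 2 := by
  rw [envCheb_step r 15 (by norm_num) r.iRbar rfl rfl]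
  simp [Row.iRbar, RExpr.eval, r.envCheb_atom]

/-- 37: `atom = 2 log q/√q · r̄`. [this cell, THETA-CERT-cc6 D4/D9] -/
theorem Row.envCheb_37 : r.envCheb 37 = 2 * r.vals 19 * (r.vals 20)⁻¹ * r.envCheb 36 := by
  rw [envCheb_step r 16 (by norm_num) r.iAtom rfl rfl]
  simp [Row.iAtom, RExpr.eval, r.envCheb_atom]

/-- 38: `loss = primesC + cross + arch + atom`. [this cell, THETA-CERT-cc6 D9] -/
theorem Row.envCheb_38 : r.envCheb 38 = r.envCheb 30 + r.envCheb 31 + r.envCheb 34 + r.envCheb 37 := by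
  rw [envCheb_step r 17 (by norm_num) r.iLoss rfl rfl]
  simp [Row.iLoss, RExpr.eval]

/-- 39: `gain = 2 I_lo log q`. [this cell, THETA-CERT-cc6 D8/D9] -/
theorem Row.envCheb_39 : r.envCheb 39 = ((2 * r.Ilo : ℚ) : ℝ) * r.vals 19 := by
  rw [envCheb_step r 18 (by norm_num) r.iGain rfl rfl]
  simp [Row.iGain, RExpr.eval, r.envCheb_atom]

/-- 40: `e^{2δ} q`. [this cell, THETA-CERT-cc6 §D] -/
theorem Row.envCheb_40 : r.envCheb 40 = r.vals 12 * ((r.q : ℚ) : ℝ) := by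
  rw [envCheb_step r 19 (by norm_num) r.iWin rfl rfl]
  simp [Row.iWin, RExpr.eval, r.envCheb_atom]

/-- `lossCheb` and `gainCheb` are registers `38` and `39`. [this cell, THETA-CERT-cc6 D9] -/
theorem Row.lossCheb_gainCheb : r.lossCheb = r.envCheb 38 ∧ r.gainCheb = r.envCheb 39 := ⟨rfl, rfl⟩

/-- 41: `log N = log q + (2δ − 2η′)`. [this cell] -/
theorem Row.envCheb_41 : r.envCheb 41 = r.vals 19 + ((2 * r.delta - 2 * ETA : ℚ) : ℝ) := by
  rw [envCheb_step r 20 (by norm_num) r.iLogN rfl rfl]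
  simp [Row.iLogN, RExpr.eval, r.envCheb_atom]

end Registers

end Summit.RiemannHypothesis.RiemannHypothesis.Theorems.ThetaTier1
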